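import Summits.ABC.IUTFork.Joshi.ATS4DescentSpineAbcTheta
import HarnessLib

/-!
# [J-IV] (arXiv:2403.10430v2) §6.8–§6.12 ⟶ §7: CALIBRATION of the typed descent inputs — the nine named §6.8–§6.11
# reading predicates on an existentially quantified carrier are EQUIVALENT to ONE explicit real inequality

Proof-only companion (0 defs) of the abc-iut cell, branch E «type Joshi's construction, test vs S» (rung LADDER-ABC:A2.E), seat
abc-iut-E-t35 (gen 5); reader-companion of `Joshi/ATS4DescentSpineAbcTheta.lean` (E-t30 gen 3, p443293), located by its RQ7
second read (HOME/staging/E/t35/audit/AUDIT-p443293.md, INFO-1); parents BUILT, every input BY NAME. SOURCE: K. Joshi,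
*Construction of Arithmetic Teichmüller Spaces IV*, arXiv:2403.10430v2 (unrefereed; bib `Joshi2024ATS4`): Thm. 6.1.1 p.58 l.1–23,
Lemma 6.7.8 p.62 l.22–27, (6.8.11) p.64 l.2–3, Prop. 6.10.9 p.69 l.1–28, Thm. 6.10.1 p.66 l.12–61, (6.11.1) p.69 l.73 – p.70 l.3,
(6.11.7) p.71 l.89–110, §6.12 p.72 l.2–31; page/line = the cell's render `HOME/lit/renders/Joshi-arxiv-2403.10430/`.

FRAMING (binding): an EQUIVALENCE between (a conjunction of) reading predicates typed from a third party's unrefereed text and a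
real inequality in the same carrier's data. NO side is taken on [IUTchIII] Cor. 3.12 / [IUTchIV] Thm. 1.10, on Joshi's claims, or
on Mochizuki's report on them; NOT a test verdict; NO abc claim. Typed ≠ proved ≠ endorsed.

WHAT IS CALIBRATED. In `abc_of_thetaTowerDescentInputs` (p443293) — as in E-t31's `thm611_left_of_inputs` — the §6.8–§6.11
quantities live on ONE real carrier `dd : LocusVolumeDatum`, EXISTENTIALLY quantified and tied to the Thm-6.1.1 carrier
`M : MainBoundDatum` only through `MainBoundGlue` (eight equalities: `ℓ, d_mod, e*_mod, η_prm = 60, log d_{L_tpd}, log f_{L_tpd},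
log d_{L′}, log q`); the hull log-volumes (`logVolHull`, `logVolHullFrob`, `logVolAt`, `logVolArch`), `|log q_ℓ|` (both
arithmeticoids), `log s_ℚ`, `log s^≤` (and components) and `V^dst_ℚ` are pinned to NO typed object. Consequently:
1. `LocusVolumeDatum.ineq_of_inputs` (⇒): on EVERY carrier, eight of the nine named inputs — (6.11.1) `Eq6111`, Prop. 6.10.9 on
   `V^dst` `Prop6109`, `ComponentSums`, (6.8.11) `Eq6811`, Lemma 6.7.8 `Lem678`, the LOWER BOUND `LowerBound` (= [J-III] Cor.
   9.11.1.1 at `φ(y₀)`, Joshi's analogue of Cor. 3.12), `FrobShiftVol`, «(1/2ℓ) log q = |log q_ℓ|» `LogqDictionary` (`FrobShiftQ`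
   is idle) — imply the single inequality
     (E) `(1/6 − 2/(ℓ(ℓ+1)))·log q ≤ (1 + 4/ℓ)·log d_{L′} + (8·d_mod/ℓ)·(log d_{L_tpd} + log f_{L_tpd}) + (4/ℓ)·log(2·3·5·ℓ) + (80/9)·(e*_mod·ℓ + η_prm)`
   (archimedean term bounded by `0`, not by the printed `ℓ + 1` of Prop. 6.10.12, so that (E) is sharp: see 2).
2. `MainBoundDatum.exists_glue_inputs_of_ineq` (⇐): for EVERY `M`, (E) at `M` (`η_prm = 60`) yields a glued carrier satisfying
   ALL NINE inputs — explicit witness: one distinguished prime carrying every component, hull log-volume `ℓ*·log q/(2ℓ)`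
   SATURATING the lower bound, `log s_ℚ`, `log s^≤` AT their printed caps (6.8.11) / Lemma 6.7.8.
3. `MainBoundDatum.exists_glue_inputs_iff`: `(∃ dd, MainBoundGlue M dd ∧ the nine inputs) ↔ (E at M)`.
4. `abc_of_thetaTowerIneq`: p443293's `abc_of_thetaTowerDescentInputs` with its `∃ dd, glue ∧ nine` block REPLACED by (E) at the
   genuine theta datum `MainBoundDatum.ofGenuine …` — same conclusion `ABC`, by 2.
RUNG CURRENCY (A2.E; §M E5 sentence «what remains per λ-line point»): as typed, the descent antecedent per point is {theta field
`F`, `K ⊆ F(E[ℓ])` Galois, `ℓ ≥ 7` prime of Lemma 5.8.7, `V^{odd,ss} ≠ ∅`, `d_mod ≤ d`} ∧ (E) at the genuine datum — ONE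
Thm-6.1.1-shaped inequality in GENUINE quantities (`log q`, `log d_{F_tpd}`, `log f_{F_tpd}`, `log d_{L′}`, `d_mod`, `e_mod`, `ℓ`); no
hull-volume / Cor-3.12-strength conjunct survives independently (the lower bound is met by CHOOSING the free volume slot). This is
bookkeeping about OUR typing («volume-shaped, S-bypassed», E-t30/E-t31), not a statement about print. Theorems only; standard
axioms; no `sorry`, instance, notation, `def` or new `Prop`. [claim: Joshi2024ATS4, status: disputed].
-/

noncomputable section

namespace Summit.ABC.IUTFork.Joshi.ATS4

open Literature.NumberTheory.DiophantineGeometry Literature.NumberTheory.DiophantineGeometry.GenEll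
open Literature.NumberTheory.EllipticCurves
open Literature.IUT.LogVolume Literature.IUT.LogVolume.Cor22

/-! ## 1. (⇒) the nine inputs imply (E), on any carrier -/

namespace LocusVolumeDatum

variable (d : LocusVolumeDatum)

/-- **(⇒) Eight of the nine named §6.8–§6.11 inputs imply the single inequality (E)** on ANY carrier: chain `−|log q_ℓ| ≤ −(1/ℓ*)|log Vol(φ(y₀))| =
−(1/ℓ*)|log Vol(y₀)| = −(1/ℓ*)(Σ_{V^dst}|·| + |·_∞|) ≤ Σ_{V^dst} ((ℓ+1)/4)·{…}` (Thm. 6.10.1 p.66, (6.11.1)–(6.11.2) p.69–70), then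
`|log q_ℓ| = log q/(2ℓ)` ((6.11.7)), the caps (6.8.11) / Lemma 6.7.8, and division by `(ℓ+1)/4 > 0`. `FrobShiftQ` is not used.
PROVED (real arithmetic over the typed predicates; nothing of print asserted). [claim: Joshi2024ATS4, status: disputed] -/
theorem ineq_of_inputs (h₁ : d.Eq6111) (h₂ : ∀ p ∈ d.Vdst, d.Prop6109 p) (h₃ : d.ComponentSums) (h₅ : d.Eq6811)
    (h₆ : d.Lem678) (h₇ : d.LowerBound) (h₉ : d.FrobShiftVol) (hD : d.LogqDictionary) :
    (1 / 6 - 2 / ((d.l : ℝ) * ((d.l : ℝ) + 1))) * d.logq ≤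
      (1 + 4 / (d.l : ℝ)) * d.logDiffLp + 8 * (d.dmod : ℝ) / d.l * (d.logDiffTpd + d.logCondTpd)
        + 4 / (d.l : ℝ) * Real.log (2 * 3 * 5 * (d.l : ℝ)) + 80 / 9 * (d.estar * d.l + d.eta) := by
  have hl5 : (5 : ℝ) ≤ d.l := d.five_le_l_real
  have hl : (0 : ℝ) < d.l := by linarith
  have hls : 0 < d.lstar := d.lstar_pos
  have ht : (0 : ℝ) < ((d.l : ℝ) + 1) / 4 := by positivity
  -- Prop. 6.10.9 summed over `V^dst`
  have hsum := Finset.sum_le_sum fun p hp => h₂ p hp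
  have hL : ∑ p ∈ d.Vdst, (-(1 / d.lstar) * |d.logVolAt p|) = -(1 / d.lstar) * ∑ p ∈ d.Vdst, |d.logVolAt p| := by
    rw [Finset.mul_sum]
  have hR : ∑ p ∈ d.Vdst, (((d.l : ℝ) + 1) / 4 *
      ((1 + 4 / (d.l : ℝ)) * d.logDiffLpAt p - 1 / 6 * d.logqAt p + 4 / (d.l : ℝ) * d.logsQAt p
        + 20 / 3 * d.estar * d.logsLeAt p)) =
      ((d.l : ℝ) + 1) / 4 * ((1 + 4 / (d.l : ℝ)) * d.logDiffLp - 1 / 6 * d.logq + 4 / (d.l : ℝ) * d.logsQ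
        + 20 / 3 * d.estar * d.logsLe) := by
    obtain ⟨ha, hb, hc, he⟩ := h₃
    rw [← ha, ← hb, ← hc, ← he, ← Finset.mul_sum]
    congr 1
    simp only [Finset.sum_add_distrib, Finset.sum_sub_distrib, Finset.mul_sum]
  rw [hL, hR] at hsum
  -- the archimedean contribution is `≤ 0`
  have harch : -(1 / d.lstar) * |d.logVolArch| ≤ 0 := by
    have := abs_nonneg d.logVolArch
    have : 0 ≤ 1 / d.lstar := (one_div_pos.mpr hls).le
    nlinarith
  -- the chain from the lower bound
  have hA : d.absLogThetaQ = 1 / (2 * (d.l : ℝ)) * d.logq := hD.symm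
  have hApos : 0 < d.absLogThetaQ := d.absLogThetaQ_pos
  have habsA : |d.absLogThetaQ| = d.absLogThetaQ := abs_of_pos hApos
  have hchain : -(1 / (2 * (d.l : ℝ)) * d.logq) ≤
      ((d.l : ℝ) + 1) / 4 * ((1 + 4 / (d.l : ℝ)) * d.logDiffLp - 1 / 6 * d.logq + 4 / (d.l : ℝ) * d.logsQ
        + 20 / 3 * d.estar * d.logsLe) := by
    have h7' : -|d.absLogThetaQ| ≤ -(1 / d.lstar) * |d.logVolHull| := by
      have := h₇; unfold LowerBound at this; unfold FrobShiftVol at h₉; rw [h₉] at this; exact this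
    unfold Eq6111 at h₁
    rw [h₁, habsA, hA] at h7'
    have : -(1 / d.lstar) * (∑ p ∈ d.Vdst, |d.logVolAt p| + |d.logVolArch|) =
        -(1 / d.lstar) * ∑ p ∈ d.Vdst, |d.logVolAt p| + -(1 / d.lstar) * |d.logVolArch| := by ring
    linarith
  -- the caps (6.8.11) and Lemma 6.7.8
  have hcapQ : 4 / (d.l : ℝ) * d.logsQ ≤
      4 / (d.l : ℝ) * (2 * (d.dmod : ℝ) * (d.logDiffTpd + d.logCondTpd) + Real.log (2 * 3 * 5 * (d.l : ℝ))) :=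
    mul_le_mul_of_nonneg_left h₅ (by positivity)
  have hcapLe : 20 / 3 * d.estar * d.logsLe ≤ 80 / 9 * (d.estar * d.l + d.eta) := by
    have := h₆; unfold Lem678 at this; nlinarith
  -- divide by `(ℓ+1)/4`
  have key : ((d.l : ℝ) + 1) / 4 * ((1 / 6 - 2 / ((d.l : ℝ) * ((d.l : ℝ) + 1))) * d.logq) =
      ((d.l : ℝ) + 1) / 4 * (1 / 6 * d.logq) - 1 / (2 * (d.l : ℝ)) * d.logq := by
    field_simp
    ring
  refine le_of_mul_le_mul_left ?_ ht
  rw [key]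
  have hmono := mul_le_mul_of_nonneg_left (add_le_add hcapQ hcapLe) ht.le
  have e1 : ((d.l : ℝ) + 1) / 4 * ((1 + 4 / (d.l : ℝ)) * d.logDiffLp - 1 / 6 * d.logq + 4 / (d.l : ℝ) * d.logsQ
        + 20 / 3 * d.estar * d.logsLe) =
      ((d.l : ℝ) + 1) / 4 * ((1 + 4 / (d.l : ℝ)) * d.logDiffLp) - ((d.l : ℝ) + 1) / 4 * (1 / 6 * d.logq)
        + ((d.l : ℝ) + 1) / 4 * (4 / (d.l : ℝ) * d.logsQ + 20 / 3 * d.estar * d.logsLe) := by ring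
  have e2 : ((d.l : ℝ) + 1) / 4 * ((1 + 4 / (d.l : ℝ)) * d.logDiffLp + 8 * (d.dmod : ℝ) / d.l * (d.logDiffTpd + d.logCondTpd)
        + 4 / (d.l : ℝ) * Real.log (2 * 3 * 5 * (d.l : ℝ)) + 80 / 9 * (d.estar * d.l + d.eta)) =
      ((d.l : ℝ) + 1) / 4 * ((1 + 4 / (d.l : ℝ)) * d.logDiffLp)
        + ((d.l : ℝ) + 1) / 4 * (4 / (d.l : ℝ) * (2 * (d.dmod : ℝ) * (d.logDiffTpd + d.logCondTpd)
          + Real.log (2 * 3 * 5 * (d.l : ℝ))) + 80 / 9 * (d.estar * d.l + d.eta)) := by ring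
  rw [e1] at hchain
  rw [e2]
  linarith [hchain, hmono]

end LocusVolumeDatum

/-! ## 2. (⇐) an explicit glued carrier from (E), and the equivalence -/

namespace MainBoundDatum

variable (M : MainBoundDatum)

/-- **(⇐) From (E) at `M` (with `η_prm = 60`), an explicit glued carrier satisfying ALL NINE named inputs.**
Witness: `V^dst := {2}` carrying every component; `|log q_ℓ| := log q/(2ℓ)` for both arithmeticoids; all four hull log-volume
slots `:= ℓ*·log q/(2ℓ)` except the archimedean one `:= 0` (so the lower bound and (6.11.1) hold with EQUALITY); `log s_ℚ :=` the
right side of (6.8.11); `log s^≤ := (4/3)(e*ℓ + 60)/e*` (Lemma 6.7.8 with equality). Then Prop. 6.10.9 at `2` IS (E). PROVED.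
[claim: Joshi2024ATS4, status: disputed] -/
theorem exists_glue_inputs_of_ineq
    (h : (1 / 6 - 2 / ((M.ell : ℝ) * ((M.ell : ℝ) + 1))) * M.logq ≤
      (1 + 4 / (M.ell : ℝ)) * M.logDiffLp + 8 * (M.dmod : ℝ) / M.ell * (M.logDiffLtpd + M.logCondLtpd)
        + 4 / (M.ell : ℝ) * Real.log (2 * 3 * 5 * (M.ell : ℝ)) + 80 / 9 * ((M.estar : ℝ) * M.ell + 60)) :
    ∃ dd : LocusVolumeDatum, MainBoundGlue M dd ∧ dd.Eq6111 ∧ (∀ p ∈ dd.Vdst, dd.Prop6109 p) ∧ dd.ComponentSums ∧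
      dd.Eq6811 ∧ dd.Lem678 ∧ dd.LowerBound ∧ dd.FrobShiftQ ∧ dd.FrobShiftVol ∧ dd.LogqDictionary := by
  have hl5 : (5 : ℝ) ≤ M.ell := M.five_le_ell_real
  have hl : (0 : ℝ) < M.ell := by linarith
  have hq : 0 < M.logq := M.logq_pos
  have hest : (552960 : ℝ) ≤ (M.estar : ℝ) := by
    have h1 : (1 : ℝ) ≤ M.emod := by exact_mod_cast M.one_le_emod
    unfold MainBoundDatum.estar; push_cast; nlinarith
  have hest0 : (0 : ℝ) < (M.estar : ℝ) := by linarith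
  have hA : 0 < 1 / (2 * (M.ell : ℝ)) * M.logq := by positivity
  have hls : (0 : ℝ) < ((M.ell : ℝ) - 1) / 2 := by linarith
  have hl1 : (M.ell : ℝ) - 1 ≠ 0 := by linarith
  have heta : (0 : ℝ) ≤ etaPrm := by unfold etaPrm; norm_num
  refine ⟨{
      l := M.ell, five_le_l := M.five_le_ell, dmod := M.dmod, one_le_dmod := M.one_le_dmod,
      estar := (M.estar : ℝ), estar_ge := hest, eta := etaPrm, eta_nonneg := heta,
      logDiffTpd := M.logDiffLtpd, logDiffTpd_nonneg := M.logDiffLtpd_nonneg,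
      logCondTpd := M.logCondLtpd, logCondTpd_nonneg := M.logCondLtpd_nonneg, logDiffLp := M.logDiffLp,
      logq := M.logq, logq_nonneg := hq.le,
      logsQ := 2 * (M.dmod : ℝ) * (M.logDiffLtpd + M.logCondLtpd) + Real.log (2 * 3 * 5 * (M.ell : ℝ)),
      logsLe := 4 / 3 * ((M.estar : ℝ) * M.ell + 60) / M.estar, Vdst := {2},
      logDiffLpAt := fun _ => M.logDiffLp, logqAt := fun _ => M.logq,
      logsQAt := fun _ => 2 * (M.dmod : ℝ) * (M.logDiffLtpd + M.logCondLtpd) + Real.log (2 * 3 * 5 * (M.ell : ℝ)),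
      logsLeAt := fun _ => 4 / 3 * ((M.estar : ℝ) * M.ell + 60) / M.estar,
      logVolAt := fun _ => ((M.ell : ℝ) - 1) / 2 * (1 / (2 * (M.ell : ℝ)) * M.logq), logVolArch := 0,
      logVolHull := ((M.ell : ℝ) - 1) / 2 * (1 / (2 * (M.ell : ℝ)) * M.logq),
      logVolHullFrob := ((M.ell : ℝ) - 1) / 2 * (1 / (2 * (M.ell : ℝ)) * M.logq),
      absLogThetaQ := 1 / (2 * (M.ell : ℝ)) * M.logq, absLogThetaQ_pos := hA,
      absLogThetaQFrob := 1 / (2 * (M.ell : ℝ)) * M.logq },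
    ⟨rfl, rfl, rfl, rfl, rfl, rfl, rfl, rfl⟩, ?_, ?_, ?_, ?_, ?_, ?_, ?_, ?_, ?_⟩
  · -- (6.11.1)
    unfold LocusVolumeDatum.Eq6111
    simp only [Finset.sum_singleton, abs_zero, add_zero]
  · -- Prop. 6.10.9 at the one distinguished prime IS (E)
    intro p _
    unfold LocusVolumeDatum.Prop6109 LocusVolumeDatum.lstar
    dsimp only
    have hV : |((M.ell : ℝ) - 1) / 2 * (1 / (2 * (M.ell : ℝ)) * M.logq)| =
        ((M.ell : ℝ) - 1) / 2 * (1 / (2 * (M.ell : ℝ)) * M.logq) := abs_of_pos (mul_pos hls hA)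
    rw [hV]
    have hsLe : 20 / 3 * (M.estar : ℝ) * (4 / 3 * ((M.estar : ℝ) * M.ell + 60) / M.estar) =
        80 / 9 * ((M.estar : ℝ) * M.ell + 60) := by
      field_simp
      ring
    have hlhs : -(1 / (((M.ell : ℝ) - 1) / 2)) * (((M.ell : ℝ) - 1) / 2 * (1 / (2 * (M.ell : ℝ)) * M.logq)) =
        -(1 / (2 * (M.ell : ℝ)) * M.logq) := by
      field_simp
    rw [hsLe, hlhs]
    have ht : (0 : ℝ) < ((M.ell : ℝ) + 1) / 4 := by positivity
    have key : ((M.ell : ℝ) + 1) / 4 * ((1 / 6 - 2 / ((M.ell : ℝ) * ((M.ell : ℝ) + 1))) * M.logq) =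
        ((M.ell : ℝ) + 1) / 4 * (1 / 6 * M.logq) - 1 / (2 * (M.ell : ℝ)) * M.logq := by
      field_simp
      ring
    have hmono := mul_le_mul_of_nonneg_left h ht.le
    rw [key] at hmono
    have e1 : ((M.ell : ℝ) + 1) / 4 * ((1 + 4 / (M.ell : ℝ)) * M.logDiffLp - 1 / 6 * M.logq
          + 4 / (M.ell : ℝ) * (2 * (M.dmod : ℝ) * (M.logDiffLtpd + M.logCondLtpd) + Real.log (2 * 3 * 5 * (M.ell : ℝ)))
          + 80 / 9 * ((M.estar : ℝ) * M.ell + 60)) =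
        ((M.ell : ℝ) + 1) / 4 * ((1 + 4 / (M.ell : ℝ)) * M.logDiffLp + 8 * (M.dmod : ℝ) / M.ell * (M.logDiffLtpd + M.logCondLtpd)
          + 4 / (M.ell : ℝ) * Real.log (2 * 3 * 5 * (M.ell : ℝ)) + 80 / 9 * ((M.estar : ℝ) * M.ell + 60))
          - ((M.ell : ℝ) + 1) / 4 * (1 / 6 * M.logq) := by ring
    rw [e1]
    linarith [hmono]
  · -- component sums over the singleton
    unfold LocusVolumeDatum.ComponentSums
    simp only [Finset.sum_singleton, and_self]
  · -- (6.8.11) with equality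
    unfold LocusVolumeDatum.Eq6811
    exact le_rfl
  · -- Lemma 6.7.8 with equality (`η_prm = 60`)
    unfold LocusVolumeDatum.Lem678 etaPrm
    dsimp only
    rw [show (M.estar : ℝ) * (4 / 3 * ((M.estar : ℝ) * M.ell + 60) / M.estar) = 4 / 3 * ((M.estar : ℝ) * M.ell + 60) by
      field_simp]
  · -- the LOWER BOUND, saturated by the chosen hull log-volume
    unfold LocusVolumeDatum.LowerBound LocusVolumeDatum.lstar
    dsimp only
    rw [abs_of_pos hA, abs_of_pos (mul_pos hls hA)]
    have : 1 / (((M.ell : ℝ) - 1) / 2) * (((M.ell : ℝ) - 1) / 2 * (1 / (2 * (M.ell : ℝ)) * M.logq)) =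
        1 / (2 * (M.ell : ℝ)) * M.logq := by
      field_simp
    nlinarith [this]
  · -- FrobShiftQ
    unfold LocusVolumeDatum.FrobShiftQ; rfl
  · -- FrobShiftVol
    unfold LocusVolumeDatum.FrobShiftVol; rfl
  · -- «(1/2ℓ) log q = |log q_ℓ|»
    unfold LocusVolumeDatum.LogqDictionary; rfl

/-- **CALIBRATION: the existentially quantified nine named inputs + glue ⟺ (E) at `M`.** (⇒) `ineq_of_inputs` through the glue
(`η_prm = 60`); (⇐) `exists_glue_inputs_of_ineq`. PROVED. [claim: Joshi2024ATS4, status: disputed] -/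
theorem exists_glue_inputs_iff :
    (∃ dd : LocusVolumeDatum, MainBoundGlue M dd ∧ dd.Eq6111 ∧ (∀ p ∈ dd.Vdst, dd.Prop6109 p) ∧ dd.ComponentSums ∧
      dd.Eq6811 ∧ dd.Lem678 ∧ dd.LowerBound ∧ dd.FrobShiftQ ∧ dd.FrobShiftVol ∧ dd.LogqDictionary) ↔
    (1 / 6 - 2 / ((M.ell : ℝ) * ((M.ell : ℝ) + 1))) * M.logq ≤
      (1 + 4 / (M.ell : ℝ)) * M.logDiffLp + 8 * (M.dmod : ℝ) / M.ell * (M.logDiffLtpd + M.logCondLtpd)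
        + 4 / (M.ell : ℝ) * Real.log (2 * 3 * 5 * (M.ell : ℝ)) + 80 / 9 * ((M.estar : ℝ) * M.ell + 60) := by
  refine ⟨?_, M.exists_glue_inputs_of_ineq⟩
  rintro ⟨dd, G, h₁, h₂, h₃, h₅, h₆, h₇, -, h₉, hD⟩
  have h := dd.ineq_of_inputs h₁ h₂ h₃ h₅ h₆ h₇ h₉ hD
  rw [G.l_eq, G.dmod_eq, G.estar_eq, G.eta_eq, G.logDiffTpd_eq, G.logCondTpd_eq, G.logDiffLp_eq, G.logq_eq] at h
  unfold etaPrm at h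
  exact h

end MainBoundDatum

/-! ## 3. p443293's E5 spine with the `∃ dd` block replaced by (E) at the genuine theta datum -/

/-- **`abc_of_thetaTowerDescentInputs` (p443293) RE-READ THROUGH THE CALIBRATION.** If at every compactly bounded `Z` with (5.6.2)
and every `d ≥ 1`, off an exceptional set of bounded height, every point `P = λ` of `Z ∩ U(Q̄)_{≤d}` carries a theta field `F`,
`K ⊇ F` Galois inside the `ℓ`-division field, `ℓ ≥ 7` a prime of Lemma 5.8.7, `V^{odd,ss} ≠ ∅`, an `L_mod` with `d_mod ≤ d`, AND
the single inequality (E) holds at the genuine theta datum `𝔐 = MainBoundDatum.ofGenuine L_mod … (ofNFPoint λ {2,ℓ})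
(ofNFPointOver λ {2,ℓ} F) (ofNFPointOver λ {2,ℓ} K)`, then `ABC` — by `exists_glue_inputs_of_ineq` into p443293. This is the SAME
implication with its antecedent written without the free carrier: per point ONE Thm-6.1.1-shaped inequality in genuine quantities.
PROVED AS AN IMPLICATION; NO abc claim; nothing of [J-III]/[J-IV] asserted. [claim: Joshi2024ATS4, status: disputed] -/
theorem abc_of_thetaTowerIneq
    (h : ∀ Z : CBData, Hypotheses Z → ∀ d : ℕ, 0 < d → ∃ Exc : Set NFPoint, (∃ H : ℝ, ∀ P ∈ Exc, P.ht ≤ H) ∧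
      ∀ P ∈ Z.toSet ∩ UPle d, P ∉ Exc →
        ∃ (F : Type) (_ : Field F) (_ : NumberField F) (_ : Algebra P.F F)
          (K : Type) (_ : Field K) (_ : NumberField K) (_ : Algebra F K) (_ : Algebra P.F K) (_ : IsScalarTower P.F F K)
          (_ : IsGalois F K) (ψ : K →ₐ[F] AlgebraicClosure F) (ℓ : ℕ) (hℓ : ℓ.Prime) (h5 : 5 ≤ ℓ)
          (hU : P.InU) (_ : IsThetaField P F)
          (_ : letI := thetaCurve_isElliptic hU F
            ((thetaCurve P F).galoisRepTorsion (ℓ : ℤ)).ker ≤ ψ.fieldRange.fixingSubgroup)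
          (hq : 0 < (TateDivisorDatum.ofNFPointOver P {2, ℓ} F).logq)
          (Lmod : Type) (_ : Field Lmod) (_ : NumberField Lmod),
          7 ≤ ℓ ∧ IsLem587Prime d P ℓ ∧ dMod Lmod ≤ d ∧
          (let 𝔐 := MainBoundDatum.ofGenuine Lmod hℓ h5 (TateDivisorDatum.ofNFPoint P {2, ℓ})
            (TateDivisorDatum.ofNFPointOver P {2, ℓ} F) (TateDivisorDatum.ofNFPointOver P {2, ℓ} K) hq
          (1 / 6 - 2 / ((𝔐.ell : ℝ) * ((𝔐.ell : ℝ) + 1))) * 𝔐.logq ≤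
            (1 + 4 / (𝔐.ell : ℝ)) * 𝔐.logDiffLp + 8 * (𝔐.dmod : ℝ) / 𝔐.ell * (𝔐.logDiffLtpd + 𝔐.logCondLtpd)
              + 4 / (𝔐.ell : ℝ) * Real.log (2 * 3 * 5 * (𝔐.ell : ℝ)) + 80 / 9 * ((𝔐.estar : ℝ) * 𝔐.ell + 60))) : ABC := by
  refine abc_of_thetaTowerDescentInputs fun Z hZ d hd => ?_
  obtain ⟨Exc, hExc, pts⟩ := h Z hZ d hd
  refine ⟨Exc, hExc, fun P hP hnot => ?_⟩
  obtain ⟨F, _, _, _, K, _, _, _, _, _, _, ψ, ℓ, hℓ, h5, hU, hF, hK, hq, Lmod, _, _, h7, hℓP, hdmod, hE⟩ := pts P hP hnot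
  obtain ⟨dd, G, nine⟩ := MainBoundDatum.exists_glue_inputs_of_ineq _ hE
  exact ⟨F, inferInstance, inferInstance, inferInstance, K, inferInstance, inferInstance, inferInstance, inferInstance,
    inferInstance, inferInstance, ψ, ℓ, hℓ, h5, hU, hF, hK, hq, Lmod, inferInstance, inferInstance, dd, G, h7, nine, hℓP, hdmod⟩

end Summit.ABC.IUTFork.Joshi.ATS4

end
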